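import Mathlib
import Summits.KontsevichZagierPeriods.KontsevichZagierPeriods.Theorems.HyperbolicBlochFiveTermTransferStubFiveTermIndicator

/-!
# `OffTetraSectorKernel`, line `odd-hyperbolic-ladder`: splitting a lifted simplex (stub `stub_spxSplit`)

Stub `stub_spxSplit` of the crux `OffTetraSectorKernel` (stmt-KontsevichZagierPeriods-10557, route
HyperbolicBloch), skeleton v3. Points `p = (p₀, p₁, p₂)` of the upper half space `{0 < p₂}` lift to the
paraboloid vector `Ql p = (|p|², p₀, p₁, 1) ∈ ℝ⁴`; four rows `v : Fin 4 → Fin 4 → ℝ` span the open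
geodesic simplex `Spx v = {p | 0 < p₂ ∧ ∀ a, 0 < det v · det (v with row a := Ql p)}` (all four Cramer
coordinates of `Ql p` have the sign of `det v`). If row `0` of `v` is a positive combination
`α • v i + β • u` of row `i ≠ 0` and a vector `u`, then the simplex with row `0` replaced by `u` is the
almost-disjoint union of `Spx v` and of the simplex with row `i` replaced by `u`.

Proof (multilinearity and alternation of the determinant in the rows, plus one null quadric). Let `M`
be the matrix of `v` with row `0` replaced by `u`. Then `Matrix.of v = M with row 0 := α Mᵢ + β M₀` and
the matrix of `v` with row `i` replaced by `u` is `(M with row i := M₀) with row 0 := α Mᵢ + β M₀`; all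
their one-row updates have determinants that are explicit combinations of those of `M`
(`spxSplit_det_comb…`). Writing `Xₐ = det M · det (M with row a := Ql p)`:
`p ∈ Spx v ⇔ 0 < p₂ ∧ X₀ > 0 ∧ β Xᵢ − α X₀ > 0 ∧ Xₐ > 0 (a ≠ 0, i)`,
`p ∈ Spx (v with row i := u) ⇔ 0 < p₂ ∧ Xᵢ > 0 ∧ α X₀ − β Xᵢ > 0 ∧ Xₐ > 0 (a ≠ 0, i)`,
`p ∈ Spx M ⇔ 0 < p₂ ∧ ∀ a, Xₐ > 0`. The two inclusions and the disjointness are read off, and the rest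
of `Spx M` lies on the wall `β det (M with row i := Ql p) = α det (M with row 0 := Ql p)`, the zero set of
a sphere polynomial `k₀ |p|² + k₁ p₀ + k₂ p₁ + k₃` (`FiveTerm.det_updateRow_fin_four`) which is
non-trivial (at `Q = Mᵢ` the same linear form equals `β det M ≠ 0`), hence Lebesgue-null
(`FiveTerm.volume_quadric_eq_zero`).

References: J. L. Dupont, C.-H. Sah, *Scissors congruences II*, J. Pure Appl. Algebra 25 (1982), §3
(cone/lune decompositions); the statement itself is folklore linear algebra.
-/

noncomputable section

open Set MeasureTheory

namespace Summit.KontsevichZagierPeriods.HyperbolicBloch.OffTetraSectorKernel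

section RowAlgebra

variable {n : Type*} [Fintype n] [DecidableEq n]

-- adapted from `det_updateRow_updateRow_swap` in
-- `Summits/CriticalPhenomena/SAWScalingLimit/Theorems/SAWLoopFugacityFlowAvoidanceLimitDeterminantalMatrix.lean`
/-- Exchanging the new values of two updated rows changes the sign of the determinant. [folklore] -/
theorem spxSplit_det_updateRow_updateRow_swap (A : Matrix n n ℝ) {a i : n} (h : i ≠ a)
    (r s : n → ℝ) :
    ((A.updateRow a r).updateRow i s).det = -((A.updateRow a s).updateRow i r).det := by
  have : (A.updateRow a r).updateRow i s =
      ((A.updateRow a s).updateRow i r).submatrix (Equiv.swap a i) id := by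
    ext j k
    simp only [Matrix.submatrix_apply, id, Matrix.updateRow_apply]
    by_cases hji : j = i
    · subst hji
      rw [Equiv.swap_apply_right, if_pos rfl, if_neg h.symm, if_pos rfl]
    · by_cases hja : j = a
      · subst hja
        rw [Equiv.swap_apply_left, if_neg hji, if_pos rfl, if_pos rfl]
      · rw [Equiv.swap_apply_of_ne_of_ne hja hji, if_neg hji, if_neg hja, if_neg hji, if_neg hja]
  rw [this, Matrix.det_permute, Equiv.Perm.sign_swap h.symm]
  simp

/-- `det (M with row o := α Mᵢ + β Mₒ) = β det M` for `i ≠ o`. [folklore] -/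
theorem spxSplit_det_comb (M : Matrix n n ℝ) {o i : n} (hi : i ≠ o) (α β : ℝ) :
    (M.updateRow o (α • M i + β • M o)).det = β * M.det := by
  rw [Matrix.det_updateRow_add, Matrix.det_updateRow_smul, Matrix.det_updateRow_smul,
    Matrix.det_updateRow_eq_zero hi, Matrix.updateRow_eq_self]
  ring

/-- `det ((M with row i := Q) with row o := α Mᵢ + β Mₒ) = β det (M with row i := Q) − α det (M with
row o := Q)` for `i ≠ o`. [folklore] -/
theorem spxSplit_det_updateRow_comb (M : Matrix n n ℝ) {o i : n} (hi : i ≠ o) (α β : ℝ)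
    (Q : n → ℝ) :
    ((M.updateRow i Q).updateRow o (α • M i + β • M o)).det =
      β * (M.updateRow i Q).det - α * (M.updateRow o Q).det := by
  have h1 : (M.updateRow i Q).updateRow o (M o) = M.updateRow i Q := by
    have e : M o = (M.updateRow i Q) o := (Matrix.updateRow_ne hi.symm).symm
    rw [e, Matrix.updateRow_eq_self]
  rw [Matrix.det_updateRow_add, Matrix.det_updateRow_smul, Matrix.det_updateRow_smul,
    spxSplit_det_updateRow_updateRow_swap M hi.symm Q (M i), Matrix.updateRow_eq_self, h1]
  ring

/-- Row `i` of `M with row o := α Mᵢ + β Mₒ` replaced by `Q`. [folklore] -/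
theorem spxSplit_det_comb_updateRow_i (M : Matrix n n ℝ) {o i : n} (hi : i ≠ o) (α β : ℝ)
    (Q : n → ℝ) :
    ((M.updateRow o (α • M i + β • M o)).updateRow i Q).det =
      β * (M.updateRow i Q).det - α * (M.updateRow o Q).det := by
  rw [Matrix.updateRow_comm M hi.symm, spxSplit_det_updateRow_comb M hi]

/-- Row `a ∉ {o, i}` of `M with row o := α Mᵢ + β Mₒ` replaced by `Q`. [folklore] -/
theorem spxSplit_det_comb_updateRow_other (M : Matrix n n ℝ) {o i : n} (hi : i ≠ o) (α β : ℝ)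
    {a : n} (ha : a ≠ o) (hai : a ≠ i) (Q : n → ℝ) :
    ((M.updateRow o (α • M i + β • M o)).updateRow a Q).det = β * (M.updateRow a Q).det := by
  rw [Matrix.updateRow_comm M (Ne.symm ha)]
  have e1 : M i = (M.updateRow a Q) i := (Matrix.updateRow_ne (Ne.symm hai)).symm
  have e2 : M o = (M.updateRow a Q) o := (Matrix.updateRow_ne (Ne.symm ha)).symm
  rw [e1, e2, spxSplit_det_comb _ hi]

/-- `det ((M with row i := Mₒ) with row o := α Mᵢ + β Mₒ) = -α det M` for `i ≠ o`. [folklore] -/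
theorem spxSplit_det_comb' (M : Matrix n n ℝ) {o i : n} (hi : i ≠ o) (α β : ℝ) :
    ((M.updateRow i (M o)).updateRow o (α • M i + β • M o)).det = -(α * M.det) := by
  have h0 : ((M.updateRow i (M o)).updateRow o (M o)).det = 0 :=
    Matrix.det_zero_of_row_eq hi.symm
      (by rw [Matrix.updateRow_self, Matrix.updateRow_ne hi, Matrix.updateRow_self])
  rw [Matrix.det_updateRow_add, Matrix.det_updateRow_smul, Matrix.det_updateRow_smul,
    spxSplit_det_updateRow_updateRow_swap M hi.symm (M o) (M i), Matrix.updateRow_eq_self,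
    Matrix.updateRow_eq_self, h0]
  ring

/-- Row `o` of `(M with row i := Mₒ) with row o := α Mᵢ + β Mₒ` replaced by `Q`. [folklore] -/
theorem spxSplit_det_comb'_updateRow_o (M : Matrix n n ℝ) {o i : n} (hi : i ≠ o) (α β : ℝ)
    (Q : n → ℝ) :
    (((M.updateRow i (M o)).updateRow o (α • M i + β • M o)).updateRow o Q).det =
      -(M.updateRow i Q).det := by
  have h1 : (M.updateRow i Q).updateRow o (M o) = M.updateRow i Q := by
    have e : M o = (M.updateRow i Q) o := (Matrix.updateRow_ne hi.symm).symm
    rw [e, Matrix.updateRow_eq_self]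
  rw [Matrix.updateRow_idem, spxSplit_det_updateRow_updateRow_swap M hi.symm (M o) Q, h1]

/-- Row `i` of `(M with row i := Mₒ) with row o := α Mᵢ + β Mₒ` replaced by `Q`. [folklore] -/
theorem spxSplit_det_comb'_updateRow_i (M : Matrix n n ℝ) {o i : n} (hi : i ≠ o) (α β : ℝ)
    (Q : n → ℝ) :
    (((M.updateRow i (M o)).updateRow o (α • M i + β • M o)).updateRow i Q).det =
      β * (M.updateRow i Q).det - α * (M.updateRow o Q).det := by
  rw [Matrix.updateRow_comm _ hi.symm, Matrix.updateRow_idem, spxSplit_det_updateRow_comb M hi]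

/-- Row `a ∉ {o, i}` of `(M with row i := Mₒ) with row o := α Mᵢ + β Mₒ` replaced by `Q`. [folklore] -/
theorem spxSplit_det_comb'_updateRow_other (M : Matrix n n ℝ) {o i : n} (hi : i ≠ o) (α β : ℝ)
    {a : n} (ha : a ≠ o) (hai : a ≠ i) (Q : n → ℝ) :
    (((M.updateRow i (M o)).updateRow o (α • M i + β • M o)).updateRow a Q).det =
      -(α * (M.updateRow a Q).det) := by
  rw [Matrix.updateRow_comm _ (Ne.symm ha), Matrix.updateRow_comm M (Ne.symm hai)]
  have e1 : M i = (M.updateRow a Q) i := (Matrix.updateRow_ne (Ne.symm hai)).symm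
  have e2 : M o = (M.updateRow a Q) o := (Matrix.updateRow_ne (Ne.symm ha)).symm
  rw [e1, e2, spxSplit_det_comb' _ hi]

end RowAlgebra

/-- A predicate on `Fin 4` holds everywhere iff it holds at `0`, at `i` and off `{0, i}`. [folklore] -/
theorem spxSplit_forall_fin_split {P : Fin 4 → Prop} (i : Fin 4) :
    (∀ a, P a) ↔ P 0 ∧ P i ∧ ∀ a, a ≠ 0 → a ≠ i → P a := by
  refine ⟨fun h => ⟨h 0, h i, fun a _ _ => h a⟩, fun h a => ?_⟩
  obtain ⟨h0, hi, h⟩ := h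
  by_cases ha0 : a = 0
  · rw [ha0]; exact h0
  · by_cases hai : a = i
    · rw [hai]; exact hi
    · exact h a ha0 hai

/-- Cancelling a positive factor on the left of a positive product. [folklore] -/
theorem spxSplit_pos_of_pos_mul {c x : ℝ} (hc : 0 < c) (h : 0 < c * x) : 0 < x :=
  pos_of_mul_pos_right h hc.le

/-- STUB `stub_spxSplit` (splitting a simplex through a point of an edge; one rule-(1a) instance at the
set level). If row `0` of `v` is a positive combination `α • v i + β • u` of row `i ≠ 0` and a vector `u`
(geometrically: vertex `0` lies on the open geodesic segment from vertex `i` to the point lifted by `u`),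
then the simplex with row `0` replaced by `u` is the almost-disjoint union of `Spx v` and of the simplex
with row `i` replaced by `u`: Cramer coordinates w.r.t. the three row systems differ by the explicit
substitutions, the two pieces are the signs of one linear form in the coordinates, and the wall where it
vanishes is the zero set of a non-trivial sphere polynomial `a|p|² + b p₀ + c p₁ + d` (Lebesgue-null,
`FiveTerm.volume_quadric_eq_zero`). [folklore] -/
theorem stub_spxSplit :
    ∀ (Ql : (Fin 3 → ℝ) → Fin 4 → ℝ), (∀ p, Ql p = ![p 0 ^ 2 + p 1 ^ 2 + p 2 ^ 2, p 0, p 1, 1]) →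
    ∀ (Spx : (Fin 4 → Fin 4 → ℝ) → Set (Fin 3 → ℝ)),
      (∀ v, Spx v = {p | 0 < p 2 ∧ ∀ a, 0 < (Matrix.of v).det * ((Matrix.of v).updateRow a (Ql p)).det}) →
    ∀ (v : Fin 4 → Fin 4 → ℝ) (i : Fin 4) (u : Fin 4 → ℝ) (α β : ℝ), i ≠ 0 → 0 < α → 0 < β →
      v 0 = α • v i + β • u → (Matrix.of v).det ≠ 0 →
      Spx v ⊆ Spx (Function.update v 0 u) ∧ Spx (Function.update v i u) ⊆ Spx (Function.update v 0 u) ∧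
        Disjoint (Spx v) (Spx (Function.update v i u)) ∧
        volume (Spx (Function.update v 0 u) \ (Spx v ∪ Spx (Function.update v i u))) = 0 := by
  intro Ql hQl Spx hSpx v i u α β hi hα hβ hv hD
  -- the base matrix: `v` with row `0` replaced by `u`
  obtain ⟨M, hM⟩ : ∃ M : Matrix (Fin 4) (Fin 4) ℝ, Matrix.of (Function.update v 0 u) = M := ⟨_, rfl⟩
  have hM0 : M 0 = u := by
    rw [← hM]
    exact Function.update_self (β := fun _ => Fin 4 → ℝ) 0 u v
  have hMi : M i = v i := by
    rw [← hM]
    exact Function.update_of_ne (β := fun _ => Fin 4 → ℝ) hi u v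
  have hMa : ∀ a : Fin 4, a ≠ 0 → M a = v a := fun a ha => by
    rw [← hM]
    exact Function.update_of_ne (β := fun _ => Fin 4 → ℝ) ha u v
  have hA : Matrix.of v = M.updateRow 0 (α • M i + β • M 0) := by
    rw [hMi, hM0, ← hv]
    funext a
    by_cases ha0 : a = 0
    · rw [ha0, Matrix.updateRow_self]
      rfl
    · rw [Matrix.updateRow_ne ha0, hMa a ha0]
      rfl
  have hB : Matrix.of (Function.update v i u) =
      (M.updateRow i (M 0)).updateRow 0 (α • M i + β • M 0) := by
    rw [hMi, hM0, ← hv]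
    funext a
    by_cases ha0 : a = 0
    · rw [ha0, Matrix.updateRow_self]
      exact Function.update_of_ne (Ne.symm hi) u v
    · rw [Matrix.updateRow_ne ha0]
      by_cases hai : a = i
      · rw [hai, Matrix.updateRow_self]
        exact Function.update_self i u v
      · rw [Matrix.updateRow_ne hai, hMa a ha0]
        exact Function.update_of_ne hai u v
  have hMdet : M.det ≠ 0 := by
    intro h0
    apply hD
    rw [hA, spxSplit_det_comb M hi, h0, mul_zero]
  -- the defining products of the three simplices in terms of those of `M`
  have f0 : ∀ Q, (Matrix.of v).det * ((Matrix.of v).updateRow 0 Q).det =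
      β * (M.det * (M.updateRow 0 Q).det) := by
    intro Q
    rw [hA, spxSplit_det_comb M hi, Matrix.updateRow_idem]
    ring
  have fi : ∀ Q, (Matrix.of v).det * ((Matrix.of v).updateRow i Q).det =
      β * (β * (M.det * (M.updateRow i Q).det) - α * (M.det * (M.updateRow 0 Q).det)) := by
    intro Q
    rw [hA, spxSplit_det_comb M hi, spxSplit_det_comb_updateRow_i M hi]
    ring
  have fa : ∀ Q a, a ≠ 0 → a ≠ i → (Matrix.of v).det * ((Matrix.of v).updateRow a Q).det =
      β ^ 2 * (M.det * (M.updateRow a Q).det) := by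
    intro Q a ha0 hai
    rw [hA, spxSplit_det_comb M hi, spxSplit_det_comb_updateRow_other M hi α β ha0 hai]
    ring
  have g0 : ∀ Q, (Matrix.of (Function.update v i u)).det *
      ((Matrix.of (Function.update v i u)).updateRow 0 Q).det =
        α * (M.det * (M.updateRow i Q).det) := by
    intro Q
    rw [hB, spxSplit_det_comb' M hi, spxSplit_det_comb'_updateRow_o M hi]
    ring
  have gi : ∀ Q, (Matrix.of (Function.update v i u)).det *
      ((Matrix.of (Function.update v i u)).updateRow i Q).det =
        α * (α * (M.det * (M.updateRow 0 Q).det) - β * (M.det * (M.updateRow i Q).det)) := by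
    intro Q
    rw [hB, spxSplit_det_comb' M hi, spxSplit_det_comb'_updateRow_i M hi]
    ring
  have ga : ∀ Q a, a ≠ 0 → a ≠ i → (Matrix.of (Function.update v i u)).det *
      ((Matrix.of (Function.update v i u)).updateRow a Q).det =
        α ^ 2 * (M.det * (M.updateRow a Q).det) := by
    intro Q a ha0 hai
    rw [hB, spxSplit_det_comb' M hi, spxSplit_det_comb'_updateRow_other M hi α β ha0 hai]
    ring
  -- membership in the three simplices
  have memW : ∀ p, p ∈ Spx (Function.update v 0 u) ↔
      0 < p 2 ∧ ∀ a, 0 < M.det * (M.updateRow a (Ql p)).det := by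
    intro p
    rw [hSpx, hM, mem_setOf_eq]
  have memA : ∀ p, p ∈ Spx v ↔ 0 < p 2 ∧ 0 < M.det * (M.updateRow 0 (Ql p)).det ∧
      0 < β * (M.det * (M.updateRow i (Ql p)).det) - α * (M.det * (M.updateRow 0 (Ql p)).det) ∧
      ∀ a, a ≠ 0 → a ≠ i → 0 < M.det * (M.updateRow a (Ql p)).det := by
    intro p
    rw [hSpx, mem_setOf_eq]
    constructor
    · rintro ⟨hp2, h⟩
      have h0 := h 0
      have hi' := h i
      rw [f0] at h0
      rw [fi] at hi'
      refine ⟨hp2, spxSplit_pos_of_pos_mul hβ h0, spxSplit_pos_of_pos_mul hβ hi', fun a ha0 hai => ?_⟩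
      have ha := h a
      rw [fa _ a ha0 hai] at ha
      exact spxSplit_pos_of_pos_mul (pow_pos hβ 2) ha
    · rintro ⟨hp2, h0, hi', h⟩
      refine ⟨hp2, (spxSplit_forall_fin_split i).mpr ⟨?_, ?_, fun a ha0 hai => ?_⟩⟩
      · rw [f0]; exact mul_pos hβ h0
      · rw [fi]; exact mul_pos hβ hi'
      · rw [fa _ a ha0 hai]; exact mul_pos (pow_pos hβ 2) (h a ha0 hai)
  have memB : ∀ p, p ∈ Spx (Function.update v i u) ↔
      0 < p 2 ∧ 0 < M.det * (M.updateRow i (Ql p)).det ∧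
      0 < α * (M.det * (M.updateRow 0 (Ql p)).det) - β * (M.det * (M.updateRow i (Ql p)).det) ∧
      ∀ a, a ≠ 0 → a ≠ i → 0 < M.det * (M.updateRow a (Ql p)).det := by
    intro p
    rw [hSpx, mem_setOf_eq]
    constructor
    · rintro ⟨hp2, h⟩
      have h0 := h 0
      have hi' := h i
      rw [g0] at h0
      rw [gi] at hi'
      refine ⟨hp2, spxSplit_pos_of_pos_mul hα h0, spxSplit_pos_of_pos_mul hα hi', fun a ha0 hai => ?_⟩
      have ha := h a
      rw [ga _ a ha0 hai] at ha
      exact spxSplit_pos_of_pos_mul (pow_pos hα 2) ha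
    · rintro ⟨hp2, h0, hi', h⟩
      refine ⟨hp2, (spxSplit_forall_fin_split i).mpr ⟨?_, ?_, fun a ha0 hai => ?_⟩⟩
      · rw [g0]; exact mul_pos hα h0
      · rw [gi]; exact mul_pos hα hi'
      · rw [ga _ a ha0 hai]; exact mul_pos (pow_pos hα 2) (h a ha0 hai)
  refine ⟨?_, ?_, ?_, ?_⟩
  · -- `Spx v ⊆ Spx (v with row 0 := u)`
    intro p hp
    rw [memA] at hp
    rw [memW]
    obtain ⟨hp2, h0, hi', h⟩ := hp
    refine ⟨hp2, (spxSplit_forall_fin_split i).mpr ⟨h0, ?_, h⟩⟩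
    exact spxSplit_pos_of_pos_mul hβ (by linarith [mul_pos hα h0])
  · -- `Spx (v with row i := u) ⊆ Spx (v with row 0 := u)`
    intro p hp
    rw [memB] at hp
    rw [memW]
    obtain ⟨hp2, hi', h0, h⟩ := hp
    refine ⟨hp2, (spxSplit_forall_fin_split i).mpr ⟨?_, hi', h⟩⟩
    exact spxSplit_pos_of_pos_mul hα (by linarith [mul_pos hβ hi'])
  · -- disjointness: the two middle conditions are opposite
    rw [Set.disjoint_left]
    intro p hpA hpB
    rw [memA] at hpA
    rw [memB] at hpB
    linarith [hpA.2.2.1, hpB.2.2.1]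
  · -- the rest of `Spx (v with row 0 := u)` lies on a null quadric
    have hwall : ∀ Q : Fin 4 → ℝ, β * (M.updateRow i Q).det - α * (M.updateRow 0 Q).det =
        (β * (M.updateRow i ![1, 0, 0, 0]).det - α * (M.updateRow 0 ![1, 0, 0, 0]).det) * Q 0 +
        (β * (M.updateRow i ![0, 1, 0, 0]).det - α * (M.updateRow 0 ![0, 1, 0, 0]).det) * Q 1 +
        (β * (M.updateRow i ![0, 0, 1, 0]).det - α * (M.updateRow 0 ![0, 0, 1, 0]).det) * Q 2 +
        (β * (M.updateRow i ![0, 0, 0, 1]).det - α * (M.updateRow 0 ![0, 0, 0, 1]).det) * Q 3 := by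
      intro Q
      rw [FiveTerm.det_updateRow_fin_four M i Q, FiveTerm.det_updateRow_fin_four M 0 Q]
      ring
    set k0 : ℝ := β * (M.updateRow i ![1, 0, 0, 0]).det - α * (M.updateRow 0 ![1, 0, 0, 0]).det
    set k1 : ℝ := β * (M.updateRow i ![0, 1, 0, 0]).det - α * (M.updateRow 0 ![0, 1, 0, 0]).det
    set k2 : ℝ := β * (M.updateRow i ![0, 0, 1, 0]).det - α * (M.updateRow 0 ![0, 0, 1, 0]).det
    set k3 : ℝ := β * (M.updateRow i ![0, 0, 0, 1]).det - α * (M.updateRow 0 ![0, 0, 0, 1]).det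
    have hk : ¬ (k0 = 0 ∧ k1 = 0 ∧ k2 = 0 ∧ k3 = 0) := by
      rintro ⟨e0, e1, e2, e3⟩
      have h1 := hwall (M i)
      rw [Matrix.updateRow_eq_self, Matrix.det_updateRow_eq_zero hi, e0, e1, e2, e3] at h1
      apply hMdet
      have h2 : β * M.det = 0 := by linarith
      exact (mul_eq_zero.mp h2).resolve_left hβ.ne'
    refine measure_mono_null (fun p hp => ?_) (FiveTerm.volume_quadric_eq_zero k0 k1 k2 k3 hk)
    obtain ⟨hpW, hpn⟩ := hp
    rw [memW] at hpW
    rw [mem_union, not_or, memA, memB] at hpn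
    obtain ⟨hp2, hW⟩ := hpW
    obtain ⟨hnA, hnB⟩ := hpn
    have key : β * (M.updateRow i (Ql p)).det - α * (M.updateRow 0 (Ql p)).det = 0 := by
      rcases lt_trichotomy 0 (β * (M.det * (M.updateRow i (Ql p)).det) -
          α * (M.det * (M.updateRow 0 (Ql p)).det)) with h | h | h
      · exact absurd ⟨hp2, hW 0, h, fun a _ _ => hW a⟩ hnA
      · have h2 : M.det * (β * (M.updateRow i (Ql p)).det - α * (M.updateRow 0 (Ql p)).det) = 0 := by
          linear_combination -h
        exact (mul_eq_zero.mp h2).resolve_left hMdet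
      · exact absurd ⟨hp2, hW i, by linarith, fun a _ _ => hW a⟩ hnB
    have h3 := hwall (Ql p)
    rw [key, hQl] at h3
    rw [mem_setOf_eq]
    simp only [Matrix.cons_val_zero, Matrix.cons_val_one, Matrix.cons_val] at h3
    linarith

end Summit.KontsevichZagierPeriods.HyperbolicBloch.OffTetraSectorKernel

end
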